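import Literature.Computability.QuantumComplexity.RoundedGaussianDomination
import Literature.Probability.Distributions.PseudoGaussianSamplerEstimates
import Literature.Probability.Moments.ProductLawArrays
import HarnessLib

/-!
# The ideal world of the proof of AA13 Thm. 1.3: the entry alphabet and its moments

Family `quantum-advantage`. In the ideal world of the discharge of Aaronson–Arkhipov's Thm. 1.3
(`gpeSolvableInFBPPRel_NPRel_of_approxBosonSamplingOracle`) every entry of the `m × n` array is
read off its own block of `2 L_c` uniform coins by two runs of the pseudo-Gaussian sampler
(`entryOfCoins`), so the array is a product-law array over the ENTRY ALPHABET
`A = {0,1}^{2 L_c}` with uniform weights, with values `y(a) = a₁ + a₂ i ∈ ℤ[i]` — the setting of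
`Probability/Moments/ProductLawArrays.lean` and `LinearAlgebra/Matrix/PermanentColumnPerturbation.lean`.
This file provides the dictionary and the moments those files ask for:

* `unifW P` (uniform weights), `rectExpect_unif_ite` (expectations of indicators are fractions);
* `entryOfCoins_mem_box`, `sum_entryBlock` — sums over the alphabet are sums over the box
  `(-T, T)²` against `ℓ'(z₁) ℓ'(z₂)` (`card_entryOfCoins_eq`);
* `yOf P a = a₁ + a₂ i`; **`sum_unifW_mul_yOf`** (mean zero, by the symmetry `ℓ'(-j) = ℓ'(j)`),
  **`sum_unifW_mul_norm_yOf_sq`** (`s = 2 · 4ᵇ · v`), `norm_yOf_sq_lt` (`‖y‖² < 2T²`),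
  **`sum_unifW_mul_norm_yOf_pow_four_le`** (`M₄ ≤ 2T² s`).

All proved, no new named facts.

## References

* S. Aaronson, A. Arkhipov, *The computational complexity of linear optics*, Theory of Computing 9
  (2013) 143–252, proof of Thm. 1.3, §5.2 (pp. 192–195).
-/

noncomputable section

namespace Literature.Computability.QuantumComplexity

open Finset Literature.Computability.Complexity Literature.Probability.Distributions
  Literature.Probability.Moments

variable (P : PGParams)

/-! ### The entry alphabet, uniform weights -/

/-- The entry alphabet: the `2 L_c` coins of one entry. [folklore] -/
abbrev EntryBlock : Type := List.Vector Bool (2 * P.coinLen)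

/-- Uniform weights on the entry alphabet. [folklore] -/
def unifW : EntryBlock P → ℝ := fun _ => 1 / 2 ^ (2 * P.coinLen)

/-- The weights are nonnegative. [folklore] -/
theorem unifW_nonneg (a : EntryBlock P) : 0 ≤ unifW P a := by unfold unifW; positivity

/-- The alphabet has `2^{2L_c}` letters. [folklore] -/
theorem card_entryBlock : (Fintype.card (EntryBlock P) : ℝ) = 2 ^ (2 * P.coinLen) := by
  rw [card_vector, Fintype.card_bool]; push_cast; ring

/-- The weights sum to one. [folklore] -/
theorem sum_unifW : ∑ a, unifW P a = 1 := by
  simp only [unifW, Finset.sum_const, card_univ, nsmul_eq_mul]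
  rw [card_entryBlock]
  field_simp

/-- **Expectations of indicators under uniform weights are fractions of arrays.** [folklore] -/
theorem rectExpect_unif_ite {m n : ℕ} (Q : (Fin m → Fin n → EntryBlock P) → Prop) [DecidablePred Q] :
    rectExpect (unifW P) (fun ω => if Q ω then (1 : ℝ) else 0) =
      ((univ.filter Q).card : ℝ) / Fintype.card (Fin m → Fin n → EntryBlock P) := by
  classical
  have hw : ∀ ω : Fin m → Fin n → EntryBlock P, rectWeight (unifW P) ω = ((1 / 2 ^ (2 * P.coinLen)) ^ n) ^ m := by
    intro ω; simp [rectWeight, unifW, prod_const]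
  have hsum := sum_rectWeight (m := m) (n := n) (unifW P) (sum_unifW P)
  simp_rw [hw] at hsum
  rw [Finset.sum_const, card_univ, nsmul_eq_mul] at hsum
  have hpos : (0 : ℝ) < Fintype.card (Fin m → Fin n → EntryBlock P) := by
    exact_mod_cast Fintype.card_pos
  have hc : ((1 / 2 ^ (2 * P.coinLen)) ^ n) ^ m = 1 / (Fintype.card (Fin m → Fin n → EntryBlock P) : ℝ) := by
    rw [eq_div_iff hpos.ne']; linarith
  unfold rectExpect
  simp_rw [hw]
  rw [← Finset.mul_sum, Finset.sum_boole, hc]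
  ring

/-! ### Sums over the alphabet are sums over the box `(-T, T)²` -/

/-- The box of possible entries. [folklore] -/
def box : Finset (ℤ × ℤ) := (Ioo (-(P.T : ℤ)) P.T) ×ˢ (Ioo (-(P.T : ℤ)) P.T)

/-- Membership in the box. [folklore] -/
theorem mem_box {z : ℤ × ℤ} : z ∈ box P ↔ z.1.natAbs < P.T ∧ z.2.natAbs < P.T := by
  simp only [box, mem_product, mem_Ioo]
  omega

/-- **Every entry lies in the box** (a value of `ℓ'`-mass zero is never produced). [folklore] -/
theorem entryOfCoins_mem_box (a : EntryBlock P) : entryOfCoins P a.toList ∈ box P := by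
  classical
  have hcard := card_entryOfCoins_eq P (entryOfCoins P a.toList)
  have hpos : (1 : ℝ) ≤ (univ.filter fun a' : EntryBlock P => entryOfCoins P a'.toList = entryOfCoins P a.toList).card := by
    have : 1 ≤ (univ.filter fun a' : EntryBlock P => entryOfCoins P a'.toList = entryOfCoins P a.toList).card :=
      Finset.one_le_card.2 ⟨a, by simp⟩
    exact_mod_cast this
  rw [hcard] at hpos
  rw [mem_box]
  by_contra h
  rw [not_and_or, not_lt, not_lt] at h
  rcases h with h | h
  · rw [P.law_eq_zero h] at hpos; simp at hpos; linarith
  · rw [P.law_eq_zero h] at hpos; simp at hpos; linarith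

/-- **Sums over the alphabet against the product law of the sampler**:
`∑_a g(entry a) = 2^{2L_c} ∑_{z ∈ box} ℓ'(z₁) ℓ'(z₂) g(z)`. [folklore] -/
theorem sum_entryBlock (g : ℤ × ℤ → ℝ) :
    ∑ a : EntryBlock P, g (entryOfCoins P a.toList) =
      2 ^ (2 * P.coinLen) * ∑ z ∈ box P, P.law z.1 * P.law z.2 * g z := by
  classical
  have h1 : ∀ a : EntryBlock P, g (entryOfCoins P a.toList) =
      ∑ z ∈ box P, if entryOfCoins P a.toList = z then g z else 0 := by
    intro a
    rw [Finset.sum_ite_eq, if_pos (entryOfCoins_mem_box P a)]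
  simp_rw [h1]
  rw [Finset.sum_comm, Finset.mul_sum]
  refine Finset.sum_congr rfl fun z _ => ?_
  rw [← Finset.sum_filter, Finset.sum_const, nsmul_eq_mul, card_entryOfCoins_eq]
  ring

/-! ### The entry values and their moments -/

/-- The value of an entry: `y(a) = a₁ + a₂ i`. [folklore] -/
def yOf (a : EntryBlock P) : ℂ := ((entryOfCoins P a.toList).1 : ℂ) + ((entryOfCoins P a.toList).2 : ℂ) * Complex.I

/-- `‖z₁ + z₂ i‖² = z₁² + z₂²`. [folklore] -/
theorem norm_intPair_sq (z : ℤ × ℤ) : ‖((z.1 : ℂ) + (z.2 : ℂ) * Complex.I)‖ ^ 2 = (z.1 : ℝ) ^ 2 + (z.2 : ℝ) ^ 2 := by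
  rw [Complex.sq_norm, show ((z.1 : ℂ) + (z.2 : ℂ) * Complex.I) = ((z.1 : ℝ) : ℂ) + ((z.2 : ℝ) : ℂ) * Complex.I by push_cast; rfl,
    Complex.normSq_add_mul_I]

/-- `∑_{j ∈ (-T,T)} j ℓ'(j) = 0` by the symmetry of the law. [folklore] -/
theorem sum_Ioo_mul_law : ∑ j ∈ Ioo (-(P.T : ℤ)) P.T, (j : ℝ) * P.law j = 0 := by
  have h : ∑ j ∈ Ioo (-(P.T : ℤ)) P.T, (j : ℝ) * P.law j = ∑ j ∈ Ioo (-(P.T : ℤ)) P.T, (-(j : ℝ)) * P.law j := by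
    refine Finset.sum_nbij' (fun j => -j) (fun j => -j) ?_ ?_ ?_ ?_ ?_
    · intro j hj; simp only [mem_Ioo] at hj ⊢; omega
    · intro j hj; simp only [mem_Ioo] at hj ⊢; omega
    · intro j _; simp
    · intro j _; simp
    · intro j _; rw [P.law_neg]; push_cast; ring
  have : ∑ j ∈ Ioo (-(P.T : ℤ)) P.T, (-(j : ℝ)) * P.law j = -∑ j ∈ Ioo (-(P.T : ℤ)) P.T, (j : ℝ) * P.law j := by
    rw [← Finset.sum_neg_distrib]; refine Finset.sum_congr rfl fun j _ => by ring
  linarith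

/-- **The entries are centred**: `∑_a p(a) y(a) = 0`. [folklore] -/
theorem sum_unifW_mul_yOf : ∑ a, ((unifW P a : ℝ) : ℂ) * yOf P a = 0 := by
  have hre : ∑ a : EntryBlock P, ((entryOfCoins P a.toList).1 : ℝ) = 0 := by
    rw [sum_entryBlock P (fun z => (z.1 : ℝ)), box, Finset.sum_product]
    simp_rw [show ∀ x y : ℤ, P.law x * P.law y * ((x, y).1 : ℝ) = ((x : ℝ) * P.law x) * P.law y from fun x y => by ring,
      ← Finset.mul_sum, P.sum_law, mul_one, sum_Ioo_mul_law, mul_zero]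
  have him : ∑ a : EntryBlock P, ((entryOfCoins P a.toList).2 : ℝ) = 0 := by
    rw [sum_entryBlock P (fun z => (z.2 : ℝ)), box, Finset.sum_product]
    simp_rw [show ∀ x y : ℤ, P.law x * P.law y * ((x, y).2 : ℝ) = P.law x * ((y : ℝ) * P.law y) from fun x y => by ring,
      ← Finset.mul_sum, sum_Ioo_mul_law, mul_zero, Finset.sum_const_zero, mul_zero]
  simp only [unifW, yOf]
  rw [← Finset.mul_sum, Finset.sum_add_distrib, ← Finset.sum_mul]
  have h1 : ∑ a : EntryBlock P, ((entryOfCoins P a.toList).1 : ℂ) = 0 := by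
    have := congrArg (fun x : ℝ => (x : ℂ)) hre
    push_cast at this
    exact this
  have h2 : ∑ a : EntryBlock P, ((entryOfCoins P a.toList).2 : ℂ) = 0 := by
    have := congrArg (fun x : ℝ => (x : ℂ)) him
    push_cast at this
    exact this
  rw [h1, h2]
  simp

/-- **The second moment**: `s = ∑_a p(a) ‖y(a)‖² = 2 · 4ᵇ · v`. [folklore] -/
theorem sum_unifW_mul_norm_yOf_sq : ∑ a, unifW P a * ‖yOf P a‖ ^ 2 = 2 * 4 ^ P.b * P.v := by
  have hsq : ∀ a : EntryBlock P, ‖yOf P a‖ ^ 2 =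
      ((entryOfCoins P a.toList).1 : ℝ) ^ 2 + ((entryOfCoins P a.toList).2 : ℝ) ^ 2 := fun a => norm_intPair_sq _
  simp_rw [hsq, unifW]
  rw [← Finset.mul_sum, sum_entryBlock P (fun z => (z.1 : ℝ) ^ 2 + (z.2 : ℝ) ^ 2)]
  -- the box sum: `∑ ℓ ℓ (x² + y²) = 2 ∑ j² ℓ(j)`
  have hM : ∑ j ∈ Ioo (-(P.T : ℤ)) P.T, (j : ℝ) ^ 2 * P.law j = 4 ^ P.b * P.v := by
    rw [PGParams.v, Finset.mul_sum]
    refine Finset.sum_congr rfl fun j _ => ?_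
    rw [PGParams.h]
    have : (4 : ℝ) ^ P.b = (2 ^ P.b) ^ 2 := by rw [← pow_mul, mul_comm, pow_mul]; norm_num
    rw [this]
    field_simp
  have hbox : ∑ z ∈ box P, P.law z.1 * P.law z.2 * ((z.1 : ℝ) ^ 2 + (z.2 : ℝ) ^ 2) =
      2 * (4 ^ P.b * P.v) := by
    rw [box, Finset.sum_product]
    have : ∀ x : ℤ, ∑ y ∈ Ioo (-(P.T : ℤ)) P.T, P.law x * P.law y * (((x, y).1 : ℝ) ^ 2 + ((x, y).2 : ℝ) ^ 2) =
        (x : ℝ) ^ 2 * P.law x + P.law x * ∑ y ∈ Ioo (-(P.T : ℤ)) P.T, (y : ℝ) ^ 2 * P.law y := by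
      intro x
      simp only
      simp_rw [show ∀ y : ℤ, P.law x * P.law y * ((x : ℝ) ^ 2 + (y : ℝ) ^ 2) =
        (x : ℝ) ^ 2 * P.law x * P.law y + P.law x * ((y : ℝ) ^ 2 * P.law y) from fun y => by ring]
      rw [Finset.sum_add_distrib, ← Finset.mul_sum, ← Finset.mul_sum, P.sum_law, mul_one]
    simp_rw [this]
    rw [Finset.sum_add_distrib, ← Finset.sum_mul, hM, P.sum_law, one_mul]
    ring
  rw [hbox]
  field_simp

/-- **Entries are bounded**: `‖y(a)‖² < 2T²`. [folklore] -/
theorem norm_yOf_sq_lt (a : EntryBlock P) : ‖yOf P a‖ ^ 2 < 2 * (P.T : ℝ) ^ 2 := by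
  rw [yOf, norm_intPair_sq]
  have h := (mem_box P).1 (entryOfCoins_mem_box P a)
  have h1z : |(entryOfCoins P a.toList).1| < (P.T : ℤ) := by rw [Int.abs_eq_natAbs]; exact_mod_cast h.1
  have h2z : |(entryOfCoins P a.toList).2| < (P.T : ℤ) := by rw [Int.abs_eq_natAbs]; exact_mod_cast h.2
  have h1 : |((entryOfCoins P a.toList).1 : ℝ)| < P.T := by rw [← Int.cast_abs]; exact_mod_cast h1z
  have h2 : |((entryOfCoins P a.toList).2 : ℝ)| < P.T := by rw [← Int.cast_abs]; exact_mod_cast h2z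
  have h1' := sq_lt_sq' (abs_lt.1 h1).1 (abs_lt.1 h1).2
  have h2' := sq_lt_sq' (abs_lt.1 h2).1 (abs_lt.1 h2).2
  linarith

/-- `‖y(a)‖² ≤ 2T²`. [folklore] -/
theorem norm_yOf_sq_le (a : EntryBlock P) : ‖yOf P a‖ ^ 2 ≤ 2 * (P.T : ℝ) ^ 2 := (norm_yOf_sq_lt P a).le

/-- **The fourth moment**: `M₄ = ∑_a p(a) ‖y(a)‖⁴ ≤ 2T² · s`. [folklore] -/
theorem sum_unifW_mul_norm_yOf_pow_four_le :
    ∑ a, unifW P a * ‖yOf P a‖ ^ 4 ≤ 2 * (P.T : ℝ) ^ 2 * (2 * 4 ^ P.b * P.v) := by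
  rw [← sum_unifW_mul_norm_yOf_sq, Finset.mul_sum]
  refine Finset.sum_le_sum fun a _ => ?_
  have h := norm_yOf_sq_le P a
  have hw := unifW_nonneg P a
  have : ‖yOf P a‖ ^ 4 = ‖yOf P a‖ ^ 2 * ‖yOf P a‖ ^ 2 := by ring
  rw [this]
  calc unifW P a * (‖yOf P a‖ ^ 2 * ‖yOf P a‖ ^ 2) ≤ unifW P a * (2 * (P.T : ℝ) ^ 2 * ‖yOf P a‖ ^ 2) := by
        exact mul_le_mul_of_nonneg_left (mul_le_mul_of_nonneg_right h (sq_nonneg _)) hw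
    _ = 2 * (P.T : ℝ) ^ 2 * (unifW P a * ‖yOf P a‖ ^ 2) := by ring

end Literature.Computability.QuantumComplexity
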